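import Literature.MathematicalPhysics.QuantumFieldTheory.Balaban1983to89.T4HistoryLipschitzLinearSize

/-!
# NE9FadingArithmetic — leaf N2 of the NE9 skeleton (route P1 ∘ P2): the FADING CONDITION `ω + K·lipbar·B·τ̄ < 1` of the
# history moduli, decided as REAL ARITHMETIC among the binders of the landed composition; the exact region; the reduction to
# the PRINTED standing assumptions of [II] §2 in symbolic letters; joint satisfiability of the torus face's scalar side
# conditions (cell `pub-balaban`, T⁴-continuum fan-out, `HOME/BINDER-OWNERS.md` row NE9; NE9 formalisation swarm, crew item
# (w6) «ONE kit seat for the fading arithmetic N2 (= P2 F6 = P3 L6)» of `t4/T4-NE9-TRIGGER.json` c1; unit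
# `b2b-balaban-t4-ne9-formalise-leaf-10`; LEAN PLACEMENT RULE 2026-08-19: our bookkeeping lives under `Summits/`)

HONEST FRAMING (T4-DAG PAGE 1).  The cell's T⁴ target is rung (B)+1: existence AND uniqueness of the ε → 0 limit of
gauge-invariant expectations on a FIXED finite torus T⁴ — NOT infinite volume, NOT a mass gap, NOT the Clay problem.  The spine
estimate NE9 (`T4OutputRate.NE9`, joint Lipschitz dependence of `E^{(j)}(X; g⃗, U)` on the coupling history with fading memory)
is NOT PRINTED in the audited series (cell GAPS G-t4-U3-3 and G-t4-U3-4) and is NOT PROVED here.  This module is real arithmetic about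
the SCALAR binders of the LANDED composition — the END `NE9LastCouplingBridge.ne9_and_fadingMemory_of_couplingTwoPoint`
(rate `ω + 4·lipbar·B·τ̄`), its vacuum-subtracted twin `NE9VacuumSubtractedBridge.…_vacSub` (rate `ω + 8·lipbar·B·τ̄`) and
P2's torus face `T4HistoryLipschitzLinearSize.torus_ne9_and_fadingMemory_of_linSizeDecay` (rate `ω + 4·lipbar·a₁·τ̄`) — over
ABSTRACT letters.  No `def … : Prop` is minted (trigger c3: N2 stays a displayed binder); nothing printed is asserted; the
[II]-locators below say only which printed sentence a HYPOTHESIS SHAPE types.  Spine estimates PROVED: 0/9, unchanged; leaves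
instantiated on Bałaban's objects: 0/15, unchanged.  HONEST DEPENDENCY (cell, verbatim): continuum YM on T⁴ ⇐ BetaPertH ∧ nine
spine estimates (0/9 proved); BetaPertH ⇐ (D1) ∧ (D4) ∧ CAP+tail; G-an2-4 gates asym, D1 and NE2/3/4.

WHAT THE LEAF IS (`t4/b2b-balaban-t4-ne9-p1/SKELETON-NE9-P1.md` §3 row N2; `t4/skeletons/NE9-t4-ne9-p2.md` §3 rows L13/L14).
Every END face concludes `NE9 E W κ (prodModuli ℓ (fun _ => μ)) ∧ FadingMemory (ℓ/μ) μ (…)` with `μ = ω + K·lipbar·B·τ̄`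
(K = 4, or 8 on the vacuum-subtracted faces); the END needs only `0 < μ`; the CONSUMERS (node U3 `T4OutputRate.
historySum_le_of_fadingMemory`, node U2/row NE4, node U5) need `μ < 1` (`T4HistoryLipschitzSegment.fade_iff`).  The LETTERS
are printed — in the normalisation of P2's `T4HistoryLipschitzRecursion.ChannelSize` docstring (the (1.36) amplitude
`ε₁C₁M^qe^{C₂κ₁}` inside the weight `wt`): `ω` ↔ `L⁻¹` and `τ̄` ↔ `c_τ·(6L)⁴` ([Balaban1988RG2Cluster] p. 8: «we use the factor
(L^jη)⁵ in (1.24). This yields (6L)⁴L^jη, and the sum over j is bounded by 2(6L)⁴»); `lipbar` ↔ `c″·α₄/E₀` ((2.18) p. 16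
«1/|τ(Y)| = E₀ε₁C₁α₄⁻¹M^q exp C₂κ₁ exp(−(1−3δ)κd_k(Y))» times the weight of (1.36) p. 9 gives `|τ(Y)|·wt(Y) = (α₄/E₀)·
e^{−δκd_k(Y)}`, resummed over the domains through a point as in (2.20) p. 16 «this yields a constant O(1)»); `B` ↔ the
new-term budget of the (N) profile `p₀ + B ≤ N(j+1)` (`NE9BridgeSizeInduction`; TYPE (2.41) p. 21 «|E^{(k+1)}(X)| ≤
O(1)C₃ε₁exp(…)» with «Next, we assume that O(1)C₃ε₁ ≤ ½E₀»).  The INEQUALITY `μ < 1` is ours (NOT PRINTED, GAPS G-ne9p2-3).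
Census sheet with every locator: `HOME/t4/b2b-balaban-t4-ne9-formalise-leaf-10/NE9FadingCensus.md`.

## What is PROVED (kernel; Mathlib + the one import; no `sorry`, no new axiom, 0 `def`)

§1 THE REGION of `ω + K·l·B·t < 1` [folklore]: `fade_iff_prod_lt` (↔ `l·B·t < (1 − ω)/K`), `rate_mono` (monotone in the three
nonnegative letters), `fade_iff_budget_lt` (↔ `B < (1 − ω)/(K·l·t)`: a ceiling on the new-term budget), `fade_iff_eps_lt` (one
letter linear in a small parameter ε: ↔ `ε < (1 − ω)/(K·l·b·t)`), `fade_iff_eps_sq_lt` / `fade_iff_eps_lt_sqrt` (two letters linear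
in ε: ↔ `ε² < …` ↔ `ε < √…`) — both scalings are served because the two skeletons' prose dictionaries differ (see the census).
§2 THE PRINTED LETTERS [hypothesis SHAPES only]: `rateGap_le_of_printed` — with `lipbar = c₁·α₄/E₀`, `τ̄ = c₂·(6L)⁴` and the two
located standing assumptions of [II] typed as hypotheses, `(L·M)⁴·α₄ ≤ 1` (p. 20 «(LM)⁴α₄ … bounded by a constant independent of
M, for example by 1») and `B ≤ E₀/2` (p. 21), the gap obeys `K·lipbar·B·τ̄ ≤ 648·K·c₁c₂/M⁴` (E₀ CANCELS; no ε₁ survives);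
`gap_threshold_iff` (`1/L + X/M⁴ < 1 ↔ X < (1 − 1/L)·M⁴`); `fade_of_printed` (fading ⇐ the two assumptions ∧ `648·K·c₁c₂ <
(1 − 1/L)·M⁴` — a clause of the printed TYPE «M sufficiently large», [I] Thm 3 p. 264 «M ≥ M(κ)», [II] p. 21 «we take M
sufficiently large»); `budget_le_of_p18` (C₃'s printed DEFINITION p. 20 «C₃ = 2(L+2)⁴O(1)2E₀C₁α₄⁻¹α₆⁻¹M^q exp C₂κ₁» with the
standing assumption p. 18 «Assuming 2E₀ε₁C₁α₄⁻¹α₆⁻¹M^q exp C₂κ₁ exp 5κ ≤ 1» typed as a hypothesis ⟹ `C₃ε₁ ≤ 2(L+2)⁴·c·e^{−5κ}`).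
§3 JOINT SATISFIABILITY of the torus face's scalar binders WITH fading: `torus_scalars_exist` — under four explicit smallness
inequalities S1–S4 in the instantiation letters (coefficient decay rate `a`, amplitude bound `ā ≥ α4 k`, activity amplitude
`ē ≥ ε k`, per-cube decay `y`, extracted rate `d₁`, channel weight `τ̄`, `0 < ω`), the explicit witnesses `θ₁ = 2e^{−a/2^ν}`,
`θ = 4y·e^{1+d₁}`, `a₁ = 8(D+1)·ē·y·e^{1+d₁}`, `lip k = lipbar = ā·e^a·θ₁` satisfy `hθ₁`, `hliplb`, `hlip`, `hlipb`, `hθ`, `hεθ`,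
`ha₁`, `hpos` of `torus_ne9_and_fadingMemory_of_linSizeDecay` LITERALLY, together with `μ < 1` and the value of the gap; and
the END FACE WITH ITS SCALARS DISCHARGED, `torus_ne9_and_fadingMemory_of_smallness`: that face's `NE9 ∧ FadingMemory` at an
exhibited rate `0 < μ < 1` from S1–S4, every other binder verbatim (the module's non-vacuity check on the composition).
§4 CONSUMER SIDE by name: an `example` — under `μ < 1` the history bracket of the END's moduli is `≤ (ℓ/μ)·D·(1 − μ)⁻¹` uniformly
in the creation step (`T4HistoryLipschitzRecursion.historyBracket_le_of_geometricStep`).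
§5 NUMERIC ILLUSTRATIONS (`norm_num`): at the least printed side length L = 13 ([I] p. 251 «where L is an odd, positive integer
> 11») and the smallest conceivable M = L: the room of `fade_of_printed` is `c₁c₂ < 6591/648 ≈ 10.17`
(K = 4), `< 6591/1296 ≈ 5.09` (K = 8); at M = L² = 169: `c₁c₂ < 188245551/648 ≈ 2.9·10⁵`.  No letter of Bałaban's is valued.

NOT COVERED.  Instantiating `lipbar`, `B`, `τ̄`, `ω`, `a`, `y`, `d₁`, `ē` on Bałaban's objects is the skeleton's row O1 (the
model, carver) — 0/15 today; the sharpness of the rate is P2's (`T4HistoryLipschitzRecursion` §7 toys, `fade_iff`), not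
re-proved.  Provenance: NE9 swarm seat leaf-10, 2026-08-20; census sheet and two-engine tables (`kit` jobs) in
`HOME/t4/b2b-balaban-t4-ne9-formalise-leaf-10/`.
-/

namespace Summit.QuantumFields.BalabanUV.T4Continuum.NE9FadingArithmetic

open Literature.MathematicalPhysics.QuantumFieldTheory.Balaban1983to89
open Literature.MathematicalPhysics.QuantumFieldTheory.Balaban1983to89.T4OutputRate
open Literature.MathematicalPhysics.QuantumFieldTheory.Balaban1983to89.T4HistoryLipschitzRecursion
open Literature.MathematicalPhysics.QuantumFieldTheory.Balaban1983to89.T4HistoryLipschitzOuter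
open Literature.MathematicalPhysics.QuantumFieldTheory.Balaban1983to89.T4HistoryLipschitzActivity
open Literature.MathematicalPhysics.QuantumFieldTheory.Balaban1983to89.T4HistoryLipschitzEntropy
open Literature.MathematicalPhysics.QuantumFieldTheory.Balaban1983to89.T4HistoryLipschitzCubeGeometry
open Literature.MathematicalPhysics.QuantumFieldTheory.Balaban1983to89.T4HistoryLipschitzSegment
open Literature.MathematicalPhysics.QuantumFieldTheory.Balaban1983to89.T4HistoryLipschitzLinearSize
open Literature.MathematicalPhysics.QuantumFieldTheory (Polymer.IsConn)
open Literature.Probability.LatticeModels MeasureTheory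
open scoped BoundedContinuousFunction

/-! ## §1 The region of the fading condition `ω + K·l·B·t < 1` -/

section Region

/-- The fading condition as a ceiling on the PRODUCT of the three letters: `ω + K·l·B·t < 1 ↔ l·B·t < (1 − ω)/K` (`K > 0`; K = 4
on the coupling-two-point faces, 8 on the vacuum-subtracted faces). [folklore] -/
theorem fade_iff_prod_lt {ω K l B t : ℝ} (hK : 0 < K) : ω + K * l * B * t < 1 ↔ l * B * t < (1 - ω) / K := by
  rw [lt_div_iff₀ hK, show K * l * B * t = l * B * t * K by ring]
  constructor <;> intro h <;> linarith

/-- The rate is monotone in each of the three nonnegative letters. [folklore] -/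
theorem rate_mono {ω K l l' B B' t t' : ℝ} (hK : 0 ≤ K) (hl : 0 ≤ l) (hB : 0 ≤ B) (ht : 0 ≤ t) (hll : l ≤ l')
    (hBB : B ≤ B') (htt : t ≤ t') : ω + K * l * B * t ≤ ω + K * l' * B' * t' := by
  have hl' : 0 ≤ l' := hl.trans hll
  have hB' : 0 ≤ B' := hB.trans hBB
  have h : K * l * B * t ≤ K * l' * B' * t' := by gcongr
  linarith

/-- The fading condition as a CEILING ON THE NEW-TERM BUDGET `B` at fixed Lipschitz scale and channel weight:
`ω + K·l·B·t < 1 ↔ B < (1 − ω)/(K·l·t)` (`K, l, t > 0`). [folklore] -/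
theorem fade_iff_budget_lt {ω K l B t : ℝ} (hK : 0 < K) (hl : 0 < l) (ht : 0 < t) :
    ω + K * l * B * t < 1 ↔ B < (1 - ω) / (K * l * t) := by
  rw [lt_div_iff₀ (by positivity), show K * l * B * t = B * (K * l * t) by ring]
  constructor <;> intro h <;> linarith

/-- ONE letter linear in a small parameter (`B = b·ε`, the other two ε-free — the located dictionary of the census, `B` ↔ the
(2.41) budget `O(1)C₃ε₁`): `ω + K·l·(b·ε)·t < 1 ↔ ε < (1 − ω)/(K·l·b·t)`. [folklore] -/
theorem fade_iff_eps_lt {ω K l b t ε : ℝ} (hK : 0 < K) (hl : 0 < l) (hb : 0 < b) (ht : 0 < t) :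
    ω + K * l * (b * ε) * t < 1 ↔ ε < (1 - ω) / (K * l * b * t) := by
  rw [lt_div_iff₀ (by positivity), show K * l * (b * ε) * t = ε * (K * l * b * t) by ring]
  constructor <;> intro h <;> linarith

/-- TWO letters linear in the small parameter (`B = b·ε`, `t = c·ε` — the prose dictionary of SKELETON-NE9-P1 §3 N2 «the product
carries ε₁²»): `ω + K·l·(b·ε)·(c·ε) < 1 ↔ ε² < (1 − ω)/(K·l·b·c)`. [folklore] -/
theorem fade_iff_eps_sq_lt {ω K l b c ε : ℝ} (hK : 0 < K) (hl : 0 < l) (hb : 0 < b) (hc : 0 < c) :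
    ω + K * l * (b * ε) * (c * ε) < 1 ↔ ε ^ 2 < (1 - ω) / (K * l * b * c) := by
  rw [lt_div_iff₀ (by positivity), show K * l * (b * ε) * (c * ε) = ε ^ 2 * (K * l * b * c) by ring]
  constructor <;> intro h <;> linarith

/-- The same region as a threshold on `ε ≥ 0`: `… ↔ ε < √((1 − ω)/(K·l·b·c))`. [folklore] -/
theorem fade_iff_eps_lt_sqrt {ω K l b c ε : ℝ} (hK : 0 < K) (hl : 0 < l) (hb : 0 < b) (hc : 0 < c) (hε : 0 ≤ ε) :
    ω + K * l * (b * ε) * (c * ε) < 1 ↔ ε < Real.sqrt ((1 - ω) / (K * l * b * c)) := by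
  rw [fade_iff_eps_sq_lt hK hl hb hc, Real.lt_sqrt hε]

end Region

/-! ## §2 The printed letters: the gap `K·lipbar·B·τ̄` under the located standing assumptions of [II] §2 -/

section Printed

/-- **THE GAP IN PRINT'S LETTERS.**  With the Lipschitz scale `lipbar = c₁·α₄/E₀` (TYPE (2.18) × (1.36), resummation constant
`c₁` of (2.20)), the channel weight `τ̄ = c₂·(6L)⁴` (TYPE p. 8) and the new-term budget `B`, the two located standing
assumptions typed as hypotheses — `(L·M)⁴·α₄ ≤ 1` (p. 20) and `B ≤ E₀/2` (p. 21) — give `K·lipbar·B·τ̄ ≤ 648·K·c₁c₂/M⁴`: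
the constant `E₀` cancels and no `ε₁` survives.  Hypothesis shapes only; nothing of [II] asserted.
[cite: Balaban1988RG2Cluster, p.8, (1.36) p.9, (2.18)-(2.20) p.16, p.20, (2.41) p.21] -/
theorem rateGap_le_of_printed {K L M α₄ E₀ B c₁ c₂ : ℝ} (hK : 0 ≤ K) (hM : 0 < M) (hE : 0 < E₀) (hB : 0 ≤ B)
    (hc₁ : 0 ≤ c₁) (hc₂ : 0 ≤ c₂) (h20 : (L * M) ^ 4 * α₄ ≤ 1) (h21 : B ≤ E₀ / 2) :
    K * (c₁ * α₄ / E₀) * B * (c₂ * (6 * L) ^ 4) ≤ 648 * K * (c₁ * c₂) / M ^ 4 := by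
  have hM4 : 0 < M ^ 4 := by positivity
  have hL4 : 0 ≤ L ^ 4 := by positivity
  have h1 : L ^ 4 * α₄ ≤ 1 / M ^ 4 := by
    rw [le_div_iff₀ hM4]
    calc L ^ 4 * α₄ * M ^ 4 = (L * M) ^ 4 * α₄ := by ring
      _ ≤ 1 := h20
  have h2 : B / E₀ ≤ 1 / 2 := by
    rw [div_le_iff₀ hE]
    linarith
  have hBE : 0 ≤ B / E₀ := div_nonneg hB hE.le
  calc K * (c₁ * α₄ / E₀) * B * (c₂ * (6 * L) ^ 4)
      = 1296 * K * (c₁ * c₂) * (L ^ 4 * α₄) * (B / E₀) := by ring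
    _ ≤ 1296 * K * (c₁ * c₂) * (1 / M ^ 4) * (1 / 2) := by gcongr
    _ = 648 * K * (c₁ * c₂) / M ^ 4 := by ring

/-- The threshold in `M`: `1/L + X/M⁴ < 1 ↔ X < (1 − 1/L)·M⁴` (`M > 0`). [folklore] -/
theorem gap_threshold_iff {L M X : ℝ} (hM : 0 < M) : 1 / L + X / M ^ 4 < 1 ↔ X < (1 - 1 / L) * M ^ 4 := by
  rw [← div_lt_iff₀ (by positivity : (0 : ℝ) < M ^ 4)]
  constructor <;> intro h <;> linarith

/-- **FADING FROM THE PRINTED STANDING ASSUMPTIONS, modulo ONE clause among unnamed absolute constants of the printed TYPE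
«M sufficiently large».**  Under the hypotheses of `rateGap_le_of_printed` and `648·K·c₁c₂ < (1 − 1/L)·M⁴`, the rate
`1/L + K·lipbar·B·τ̄` is `< 1`.  (At the least printed side length L = 13 and M = L the clause reads `c₁c₂ < 6591/648` for
K = 4, §5.)  Hypothesis shapes only. [cite: Balaban1988RG2Cluster, p.20, p.21; Balaban1987RG1, Thm 3 p.264] -/
theorem fade_of_printed {K L M α₄ E₀ B c₁ c₂ : ℝ} (hK : 0 ≤ K) (hM : 0 < M) (hE : 0 < E₀) (hB : 0 ≤ B)
    (hc₁ : 0 ≤ c₁) (hc₂ : 0 ≤ c₂) (h20 : (L * M) ^ 4 * α₄ ≤ 1) (h21 : B ≤ E₀ / 2)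
    (hroom : 648 * K * (c₁ * c₂) < (1 - 1 / L) * M ^ 4) :
    1 / L + K * (c₁ * α₄ / E₀) * B * (c₂ * (6 * L) ^ 4) < 1 := by
  have h := rateGap_le_of_printed hK hM hE hB hc₁ hc₂ h20 h21
  have h' : 1 / L + 648 * K * (c₁ * c₂) / M ^ 4 < 1 := (gap_threshold_iff hM).mpr hroom
  linarith

/-- **THE BUDGET FROM C₃'S PRINTED DEFINITION AND THE p. 18 STANDING ASSUMPTION.**  [II] p. 20 DEFINES «C₃ = 2(L+2)⁴O(1)2E₀C₁
α₄⁻¹α₆⁻¹M^q exp C₂κ₁» and p. 18 assumes «2E₀ε₁C₁α₄⁻¹α₆⁻¹M^q exp C₂κ₁ exp 5κ ≤ 1»; typed as hypotheses (the positive reals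
`Mq`, `eC` stand for `M^q`, `exp C₂κ₁`; `c` for the O(1)), they give `C₃ε₁ ≤ 2(L+2)⁴·c·e^{−5κ}` — the ε₁-EXPLICIT form of the
budget's smallness used in the census's threshold `ε₁⋆`.  Hypothesis shapes only. [cite: Balaban1988RG2Cluster, p.18, p.20] -/
theorem budget_le_of_p18 {L c E₀ ε₁ C₁ Mq eC κ α₄ α₆ : ℝ} (hc : 0 ≤ 2 * (L + 2) ^ 4 * c) (hα₄ : 0 < α₄) (hα₆ : 0 < α₆)
    (h18 : 2 * E₀ * ε₁ * C₁ * Mq * eC * Real.exp (5 * κ) ≤ α₄ * α₆) :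
    2 * (L + 2) ^ 4 * c * (2 * E₀ * ε₁ * C₁ * Mq * eC / (α₄ * α₆)) ≤
      2 * (L + 2) ^ 4 * c * Real.exp (-(5 * κ)) := by
  have hpos : 0 < α₄ * α₆ := mul_pos hα₄ hα₆
  have hE : Real.exp (5 * κ) * Real.exp (-(5 * κ)) = 1 := by
    rw [← Real.exp_add, add_neg_cancel, Real.exp_zero]
  have h1 : 2 * E₀ * ε₁ * C₁ * Mq * eC / (α₄ * α₆) ≤ Real.exp (-(5 * κ)) := by
    rw [div_le_iff₀ hpos]
    calc 2 * E₀ * ε₁ * C₁ * Mq * eC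
        = 2 * E₀ * ε₁ * C₁ * Mq * eC * Real.exp (5 * κ) * Real.exp (-(5 * κ)) := by
          rw [mul_assoc _ (Real.exp (5 * κ)), hE, mul_one]
      _ ≤ α₄ * α₆ * Real.exp (-(5 * κ)) := mul_le_mul_of_nonneg_right h18 (Real.exp_pos _).le
      _ = Real.exp (-(5 * κ)) * (α₄ * α₆) := mul_comm _ _
  exact mul_le_mul_of_nonneg_left h1 hc

end Printed

/-! ## §3 Joint satisfiability of the torus face's scalar side conditions together with fading -/

section TorusScalars

/-- **THE SCALAR BINDERS OF `torus_ne9_and_fadingMemory_of_linSizeDecay` ARE JOINTLY SATISFIABLE WITH A FADING RATE.**  Given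
the instantiation letters — chart degree `D`, dimension index `ν`, coefficient decay rate `a` and amplitude bound `ā ≥ α4 k`
(`ā > 0`), activity amplitudes `ε k ≤ ē`, per-cube decay `y ≥ 0`, extracted rate `d₁`, channel weight `τ̄ ≥ 0`, per-step factor
`0 < ω`, explicit-part bounds `p₀ j ≤ p̄` — and the four smallness inequalities
S1 `2D·e^{−a/2^ν} ≤ log 2`, S2 `4D·y·e^{1+d₁} ≤ log 2`, S3 `8(D+1)·ē·y·e^{1+d₁} ≤ 1`, S4 `64(D+1)·ā·e^a·e^{−a/2^ν}·e^{1+d₁}·ē·y·τ̄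
< 1 − ω`, the witnesses `θ₁ = 2e^{−a/2^ν}`, `θ = 4y·e^{1+d₁}`, `a₁ = 2ē·θ·(D+1)`, `lip k = lipbar = ā·e^a·θ₁`, `Nsz ≡ p̄ + 1`
satisfy the face's binders `hθ₁`, `hliplb`, `hlip`, `hlipb`, `hθ`, `hεθ`, `ha₁`, `hNsucc`, `hNnn`, `hpos` LITERALLY, and the rate
`ω + 4·lipbar·a₁·τ̄` FADES.  In print's TYPE: S1 ↔ (1.26) p. 8 «for κ sufficiently large»; S2/S3 ↔ p. 18 «For κ sufficiently
large and α₆ sufficiently small we have (2.29)», p. 21 «the constant C₃ε₁ is small anyway»; S4 = the fading condition in the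
instantiation letters (NOT PRINTED).  Arithmetic only; nothing about Bałaban's objects.
[cite: Balaban1988RG2Cluster, (1.26) p.8, p.18, p.21] -/
theorem torus_scalars_exist {ν D : ℕ} {a abar y d₁ ebar τbar ω : ℝ} {α4 ε : ℕ → ℝ} (habar : 0 < abar)
    (hα4 : ∀ k, α4 k ≤ abar) (hy : 0 ≤ y) (hebar : 0 ≤ ebar) (hεb : ∀ k, ε k ≤ ebar) (hτbar : 0 ≤ τbar) (hω : 0 < ω)
    (S1 : 2 * D * Real.exp (-(a / 2 ^ ν)) ≤ Real.log 2) (S2 : 4 * D * y * Real.exp (1 + d₁) ≤ Real.log 2)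
    (S3 : 8 * (D + 1) * ebar * y * Real.exp (1 + d₁) ≤ 1)
    (S4 : 64 * (D + 1) * abar * Real.exp a * Real.exp (-(a / 2 ^ ν)) * Real.exp (1 + d₁) * ebar * y * τbar < 1 - ω) :
    ∃ θ₁ θ a₁ lipbar : ℝ, ∃ lip : ℕ → ℝ,
      Real.exp (-(a / 2 ^ ν)) * Real.exp (D * θ₁) ≤ θ₁ ∧
      (∀ k, α4 k * Real.exp a * θ₁ ≤ lip k) ∧ (∀ k, 0 < lip k) ∧ (∀ k, lip k ≤ lipbar) ∧
      2 * y * Real.exp (a₁ + d₁) * Real.exp (D * θ) ≤ θ ∧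
      (∀ k, 2 * ε k * θ * ((D : ℝ) + 1) ≤ a₁) ∧ 0 ≤ a₁ ∧
      a₁ = 8 * ((D : ℝ) + 1) * ebar * y * Real.exp (1 + d₁) ∧
      4 * lipbar * a₁ * τbar =
        64 * ((D : ℝ) + 1) * abar * Real.exp a * Real.exp (-(a / 2 ^ ν)) * Real.exp (1 + d₁) * ebar * y * τbar ∧
      0 < ω + 4 * lipbar * a₁ * τbar ∧ ω + 4 * lipbar * a₁ * τbar < 1 := by
  have hlog2 : Real.exp (Real.log 2) = 2 := Real.exp_log (by norm_num)
  have hE1 : 0 < Real.exp (-(a / 2 ^ ν)) := Real.exp_pos _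
  have hE2 : 0 < Real.exp (1 + d₁) := Real.exp_pos _
  have hEa : 0 < Real.exp a := Real.exp_pos _
  have hD : (0 : ℝ) ≤ D := Nat.cast_nonneg D
  -- the witnesses
  have hθ₁pos : 0 < 2 * Real.exp (-(a / 2 ^ ν)) := by positivity
  have hDθ₁ : Real.exp (D * (2 * Real.exp (-(a / 2 ^ ν)))) ≤ 2 :=
    calc Real.exp (D * (2 * Real.exp (-(a / 2 ^ ν)))) ≤ Real.exp (Real.log 2) :=
          Real.exp_le_exp.mpr (by linarith)
      _ = 2 := hlog2
  have hθ0 : 0 ≤ 4 * y * Real.exp (1 + d₁) := by positivity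
  have hDθ : Real.exp (D * (4 * y * Real.exp (1 + d₁))) ≤ 2 :=
    calc Real.exp (D * (4 * y * Real.exp (1 + d₁))) ≤ Real.exp (Real.log 2) :=
          Real.exp_le_exp.mpr (by linarith)
      _ = 2 := hlog2
  have ha₁0 : 0 ≤ 2 * ebar * (4 * y * Real.exp (1 + d₁)) * ((D : ℝ) + 1) := by positivity
  have ha₁1 : 2 * ebar * (4 * y * Real.exp (1 + d₁)) * ((D : ℝ) + 1) ≤ 1 := by linarith
  have hlipbar0 : 0 < abar * Real.exp a * (2 * Real.exp (-(a / 2 ^ ν))) := by positivity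
  have hgap : 4 * (abar * Real.exp a * (2 * Real.exp (-(a / 2 ^ ν)))) *
      (2 * ebar * (4 * y * Real.exp (1 + d₁)) * ((D : ℝ) + 1)) * τbar =
      64 * ((D : ℝ) + 1) * abar * Real.exp a * Real.exp (-(a / 2 ^ ν)) * Real.exp (1 + d₁) * ebar * y * τbar := by
    ring
  refine ⟨2 * Real.exp (-(a / 2 ^ ν)), 4 * y * Real.exp (1 + d₁),
    2 * ebar * (4 * y * Real.exp (1 + d₁)) * ((D : ℝ) + 1), abar * Real.exp a * (2 * Real.exp (-(a / 2 ^ ν))),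
    fun _ => abar * Real.exp a * (2 * Real.exp (-(a / 2 ^ ν))),
    ?_, ?_, fun _ => hlipbar0, fun _ => le_rfl, ?_, ?_, ha₁0, by ring, hgap, ?_, ?_⟩
  · -- hθ₁
    calc Real.exp (-(a / 2 ^ ν)) * Real.exp (D * (2 * Real.exp (-(a / 2 ^ ν))))
        ≤ Real.exp (-(a / 2 ^ ν)) * 2 := mul_le_mul_of_nonneg_left hDθ₁ hE1.le
      _ = 2 * Real.exp (-(a / 2 ^ ν)) := mul_comm _ _
  · -- hliplb
    intro k
    exact mul_le_mul_of_nonneg_right (mul_le_mul_of_nonneg_right (hα4 k) hEa.le) hθ₁pos.le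
  · -- hθ
    have h1 : Real.exp (2 * ebar * (4 * y * Real.exp (1 + d₁)) * ((D : ℝ) + 1) + d₁) ≤ Real.exp (1 + d₁) :=
      Real.exp_le_exp.mpr (by linarith)
    calc 2 * y * Real.exp (2 * ebar * (4 * y * Real.exp (1 + d₁)) * ((D : ℝ) + 1) + d₁) *
          Real.exp (D * (4 * y * Real.exp (1 + d₁)))
        ≤ 2 * y * Real.exp (1 + d₁) * 2 := by gcongr
      _ = 4 * y * Real.exp (1 + d₁) := by ring
  · -- hεθ
    intro k
    have h := hεb k
    have hD1 : (0 : ℝ) ≤ (D : ℝ) + 1 := by positivity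
    exact mul_le_mul_of_nonneg_right (mul_le_mul_of_nonneg_right (by linarith) hθ0) hD1
  · -- hpos
    have h : 0 ≤ 4 * (abar * Real.exp a * (2 * Real.exp (-(a / 2 ^ ν)))) *
        (2 * ebar * (4 * y * Real.exp (1 + d₁)) * ((D : ℝ) + 1)) * τbar := by positivity
    linarith
  · -- fade
    rw [hgap]
    linarith

/-- **END FACE E2 WITH ITS SCALAR SIDE CONDITIONS DISCHARGED** — `T4HistoryLipschitzLinearSize.
torus_ne9_and_fadingMemory_of_linSizeDecay` with the binders `hθ₁`, `hliplb`, `hlip`, `hlipb`, `hθ`, `hεθ`, `ha₁`, `hpos` (and the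
letters `θ₁`, `θ`, `a₁`, `lip`, `lipbar`) REPLACED by the amplitude bounds `α4 k ≤ ā`, `ε k ≤ ē`, `0 < ω` and the four smallness
inequalities S1–S4 of `torus_scalars_exist`; the (N) profile is asked at the explicit pin budget `a₁ = 8(D+1)·ē·y·e^{1+d₁}`.
Conclusion: the face's `NE9 ∧ FadingMemory` at a rate `μ = ω + 4·lipbar·a₁·τbar` that is EXHIBITED, bounded
(`4·lipbar·a₁·τ̄ = 64(D+1)·ā·e^a·e^{−a/2^ν}·e^{1+d₁}·ē·y·τ̄`) and FADES (`0 < μ < 1`) — the form the consumers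
(`T4OutputRate.historySum_le_of_fadingMemory`, node U2, node U5) need.  All other binders verbatim; finite torus; nothing
about Bałaban's objects (0/15 leaves instantiated). [folklore] -/
theorem torus_ne9_and_fadingMemory_of_smallness {ν N : ℕ} {C : Carriers} {D : ℕ} {Bg : Type} {Sp : Type*}
    [TopologicalSpace Sp] [MeasurableSpace Sp] [OpensMeasurableSpace Sp] {F : Type*} [Fintype F] {Ω : Type*}
    [MeasurableSpace Ω] (Γ : CubeChart C (Fin ν → ZMod N) (torusAdj ν N) D) {ι : Type} {E : Functional C Bg}
    {W : Set (ℕ → ℝ)} {Adm : Set (Bg → C.Dom → ℝ)} {T : ℕ → (ℕ → ℝ) → (Bg → C.Dom → ℝ) → ι → ℝ}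
    {Ψ : ℕ → ℝ → (ι → ℝ) → Bg → C.Dom → ℝ}
    {μ : ℕ → ℝ → Bg → Finset (Fin ν → ZMod N) → Measure Ω} {pre : ℕ → ℝ → Bg → Finset (Fin ν → ZMod N) → Ω → ℂ}
    {c : ℕ → ℝ → Bg → Finset (Fin ν → ZMod N) → Ω → F → ℂ}
    {pt : ℕ → ℝ → Bg → Finset (Fin ν → ZMod N) → Ω → F → Sp} {β : ℕ → Sp → ℝ}
    {dom : ℕ → Finset (Fin ν → ZMod N) → F → Finset (Fin ν → ZMod N)}
    {ε α4 : ℕ → ℝ} {y d₁ κ ℓ τbar ω a abar ebar : ℝ} {wt : ℕ → ι → ℝ} {τ : ℕ → ℕ → ℝ} {lam p₀ Nsz : ℕ → ℝ}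
    (ρ : ℕ → (ι → ℝ) → (Sp →ᵇ ℂ))
    (h0 : ScaleZeroFree E W) (hAdm : AdmissibleTerms E W Adm) (hres : AdmRestrict Adm)
    (hadd : ChannelAdditive Adm T) (hsum : ChannelStepSum Adm T) (hstep : ChannelSizeAtStepNN Adm T κ wt τ)
    (hfac : Factorises E W T Ψ) (hlast : LastCouplingLipschitz E W T Ψ κ lam)
    (hρ : ∀ (k : ℕ) (P P' : ι → ℝ) (M : ℝ), (∀ y, |P y - P' y| ≤ wt k y * M) → ‖ρ k P - ρ k P'‖ ≤ M)
    (hΨ : ∀ (k : ℕ) (s : ℝ) (P P' : ι → ℝ) (U : Bg) (X : C.Dom),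
      Ψ k s P U X - Ψ k s P' U X =
        (Γ.geom.newTerm (Γ.geom.avgExpLinearAct μ pre fun k s U γ ω => evalFunctional (c k s U γ ω) (pt k s U γ ω))
            k s U X (ρ k P) -
          Γ.geom.newTerm (Γ.geom.avgExpLinearAct μ pre fun k s U γ ω => evalFunctional (c k s U γ ω) (pt k s U γ ω))
            k s U X (ρ k P')).re)
    (hexpl : ∀ g ∈ W, ∀ (k : ℕ) (P : ι → ℝ) (U : Bg) (X : C.Dom), C.scale X = k + 1 →
      |Ψ k (g k) P U X -
          (Γ.geom.newTerm (Γ.geom.avgExpLinearAct μ pre fun k s U γ ω => evalFunctional (c k s U γ ω) (pt k s U γ ω))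
            k (g k) U X (ρ k P)).re| ≤ Real.exp (-(κ * C.d X)) * p₀ k)
    (hbase : ∀ g ∈ W, ∀ (U : Bg) (X : C.Dom), C.scale X = 0 → |E g U X| ≤ Real.exp (-(κ * C.d X)) * Nsz 0)
    (hNsucc : ∀ j, p₀ j + 8 * ((D : ℝ) + 1) * ebar * y * Real.exp (1 + d₁) ≤ Nsz (j + 1)) (hNnn : ∀ j, 0 ≤ Nsz j)
    (hbox : ∀ (k : ℕ) (P : ι → ℝ), (∀ y, |P y| ≤ wt k y * sizeRadius τ Nsz k) → ∀ x, ‖ρ k P x‖ ≤ β k x)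
    (hpre : ∀ k s U γ, AEStronglyMeasurable (pre k s U γ) (μ k s U γ))
    (hc : ∀ k s U γ Y, AEStronglyMeasurable (fun ω => c k s U γ ω Y) (μ k s U γ))
    (hpt : ∀ k s U γ Y, Measurable fun ω => pt k s U γ ω Y)
    (hint₀ : ∀ k s U γ, Integrable (fun ω => ‖pre k s U γ ω‖ * Real.exp (boxExponent c pt β k s U γ ω)) (μ k s U γ))
    (hmeet : ∀ k s U (γ : Finset (Fin ν → ZMod N)) ω Y, c k s U γ ω Y ≠ 0 → ∃ x ∈ γ, x ∈ dom k γ Y)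
    (hα4 : ∀ k, 0 ≤ α4 k) (ha : 0 ≤ a) (habar : 0 < abar) (hα4b : ∀ k, α4 k ≤ abar)
    (hlin : ∀ k s U (γ : Finset (Fin ν → ZMod N)) ω Y,
      ‖c k s U γ ω Y‖ ≤ α4 k * Real.exp (-(a * (linSize (dom k γ Y) : ℝ))))
    (hdomconn : ∀ k (γ : Finset (Fin ν → ZMod N)) Y, (dom k γ Y).Nonempty →
      ∃ b ∈ dom k γ Y, Polymer.IsConn (torusAdj ν N) (dom k γ Y) b)
    (hdominj : ∀ k (γ : Finset (Fin ν → ZMod N)), Set.InjOn (dom k γ) {Y | (dom k γ Y).Nonempty})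
    (hε : ∀ k, 0 ≤ ε k) (hebar : 0 ≤ ebar) (hεb : ∀ k, ε k ≤ ebar) (hy : 0 ≤ y)
    (hdecay₀ : ∀ g ∈ W, ∀ (k : ℕ) (U : Bg) (X : C.Dom), C.scale X = k + 1 → ∀ γ' ∈ Γ.vol X,
      ∫ ω, ‖pre k (g k) U γ' ω‖ * Real.exp (boxExponent c pt β k (g k) U γ' ω) ∂(μ k (g k) U γ') ≤ ε k * y ^ γ'.card)
    (S1 : 2 * D * Real.exp (-(a / 2 ^ ν)) ≤ Real.log 2) (S2 : 4 * D * y * Real.exp (1 + d₁) ≤ Real.log 2)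
    (S3 : 8 * (D + 1) * ebar * y * Real.exp (1 + d₁) ≤ 1)
    (S4 : 64 * (D + 1) * abar * Real.exp a * Real.exp (-(a / 2 ^ ν)) * Real.exp (1 + d₁) * ebar * y * τbar < 1 - ω)
    (hκ : 0 ≤ κ) (hκd : κ ≤ d₁) (hℓ : 0 ≤ ℓ) (hτbar : 0 ≤ τbar) (hω : 0 < ω) (hlam : ∀ k, lam k ≤ ℓ)
    (hτ : ∀ k j, j ≤ k → 0 ≤ τ k j ∧ τ k j ≤ τbar * ω ^ (k - j)) :
    ∃ lipbar a₁ : ℝ,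
      4 * lipbar * a₁ * τbar =
          64 * ((D : ℝ) + 1) * abar * Real.exp a * Real.exp (-(a / 2 ^ ν)) * Real.exp (1 + d₁) * ebar * y * τbar ∧
      0 < ω + 4 * lipbar * a₁ * τbar ∧ ω + 4 * lipbar * a₁ * τbar < 1 ∧
      NE9 E W κ (prodModuli ℓ fun _ => ω + 4 * lipbar * a₁ * τbar) ∧
      FadingMemory (ℓ / (ω + 4 * lipbar * a₁ * τbar)) (ω + 4 * lipbar * a₁ * τbar)
        (prodModuli ℓ fun _ => ω + 4 * lipbar * a₁ * τbar) := by
  obtain ⟨θ₁, θ, a₁, lipbar, lip, hθ₁, hliplb, hlip, hlipb, hθ, hεθ, ha₁, ha₁eq, hgap, hpos, hfade⟩ :=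
    torus_scalars_exist (D := D) (ν := ν) habar hα4b hy hebar hεb hτbar hω S1 S2 S3 S4
  have hNsucc' : ∀ j, p₀ j + a₁ ≤ Nsz (j + 1) := fun j => by rw [ha₁eq]; exact hNsucc j
  have hEND := torus_ne9_and_fadingMemory_of_linSizeDecay Γ ρ h0 hAdm hres hadd hsum hstep hfac hlast hρ hΨ hexpl hbase
    hNsucc' hNnn hbox hpre hc hpt hlip hlipb hint₀ hmeet hα4 ha hθ₁ hliplb hlin hdomconn hdominj hε hy hdecay₀ hθ hεθ ha₁
    hκ hκd hℓ hτbar hω.le hpos hlam hτ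
  exact ⟨lipbar, a₁, hgap, hpos, hfade, hEND.1, hEND.2⟩

end TorusScalars

/-! ## §4 Consumer side, by name: the history bracket of the END's moduli under fading -/

section Consumer

/-- On the coupling-two-point faces (rate `ω + 4·lipbar·B·τ̄`, amplitude `ℓ = 4·clipbar·B + pexbar + 4·lipbar·B·qTbar`): under
fading the node-U3 history bracket is bounded UNIFORMLY in the creation step — P2's `historyBracket_le_of_geometricStep` applies
verbatim (its `c` is `4·lipbar·B·τ̄`; on the vacuum-subtracted faces read `8·` for `4·`). [folklore] -/
example {clipbar pexbar qTbar lipbar B τbar ω D : ℝ} (hℓ : 0 ≤ 4 * clipbar * B + pexbar + 4 * lipbar * B * qTbar)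
    (hpos : 0 < ω + 4 * lipbar * B * τbar) (hfade : ω + 4 * lipbar * B * τbar < 1) {gA gB : ℕ → ℝ}
    (hD : ∀ i, |gA i - gB i| ≤ D) (j : ℕ) :
    ∑ i ∈ Finset.range j,
        prodModuli (4 * clipbar * B + pexbar + 4 * lipbar * B * qTbar) (fun _ => ω + 4 * lipbar * B * τbar) j i *
          |gA i - gB i| ≤
      (4 * clipbar * B + pexbar + 4 * lipbar * B * qTbar) / (ω + 4 * lipbar * B * τbar) * D *
        (1 - (ω + 4 * lipbar * B * τbar))⁻¹ :=
  historyBracket_le_of_geometricStep hℓ hpos hfade hD j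

end Consumer

/-! ## §5 Numeric illustrations (no letter of Bałaban's is valued; two external engines reproduce the table, census sheet) -/

section Numeric

/-- L = 13, M = 13, K = 4: the room `648·K·c₁c₂ < (1 − 1/L)·M⁴` is `c₁c₂ < 6591/648` (≈ 10.17). [folklore] -/
example : (1 - 1 / 13) * (13 : ℝ) ^ 4 / (648 * 4) = 6591 / 648 := by norm_num

/-- L = 13, M = 13, K = 8 (vacuum-subtracted faces): `c₁c₂ < 6591/1296` (≈ 5.09). [folklore] -/
example : (1 - 1 / 13) * (13 : ℝ) ^ 4 / (648 * 8) = 6591 / 1296 := by norm_num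

/-- L = 13, M = L² = 169, K = 4: `c₁c₂ < 188245551/648` (≈ 2.9·10⁵). [folklore] -/
example : (1 - 1 / 13) * (169 : ℝ) ^ 4 / (648 * 4) = 188245551 / 648 := by norm_num

/-- At L = M = 13, K = 4 the product `c₁c₂ = 10` fades (`1/13 + 2592·10/13⁴ < 1`) … [folklore] -/
example : (1 : ℝ) / 13 + 648 * 4 * 10 / 13 ^ 4 < 1 := by norm_num

/-- … and `c₁c₂ = 11` does not (`1/13 + 2592·11/13⁴ > 1`): the clause «M sufficiently large» is not idle at the corner. [folklore] -/
example : ¬ ((1 : ℝ) / 13 + 648 * 4 * 11 / 13 ^ 4 < 1) := by norm_num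

/-- `fade_of_printed` fires on the illustrative corner L = M = 13, K = 4, c₁ = c₂ = 3 (c₁c₂ = 9 < 6591/648), for ANY admissible
α₄ (of either sign), E₀, B. [folklore] -/
example {α₄ E₀ B : ℝ} (hE : 0 < E₀) (hB : 0 ≤ B) (h20 : (13 * 13 : ℝ) ^ 4 * α₄ ≤ 1) (h21 : B ≤ E₀ / 2) :
    1 / 13 + 4 * (3 * α₄ / E₀) * B * (3 * (6 * 13) ^ 4) < 1 :=
  fade_of_printed (K := 4) (L := 13) (M := 13) (by norm_num) (by norm_num) hE hB (by norm_num) (by norm_num) h20 h21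
    (by norm_num)

end Numeric

end Summit.QuantumFields.BalabanUV.T4Continuum.NE9FadingArithmetic
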